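import Literature.Combinatorics.Sahi2008.Functional

/-!
# `NoHeavyLowerTail` (crux stmt-CriticalPhenomena-4575), Sahi programme P1: the LAW OF TOTAL `E_3` (tensorisation defect)

Support file (Sahi cell, seat `prim-sahi-p1`, generation 5; `--supports stmt-CriticalPhenomena-4575`).  Pure algebra, no definitions,
standard axioms, no hypotheses on the weights.

For a product weight `m₁ ⊗ m₂` and three functions `F_i` on `α × β`, write for each `x : α` the SECTION STATISTICS under `m₂`:
means `a(x), b(x), c(x)`, pair moments `ab(x), ac(x), bc(x)` and the triple moment `t(x)`.  Then `E_3^{m₁⊗m₂}(F_0,F_1,F_2)` is the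
left-hand side of `total_E3_abstract` (by `sahiE_three_apply` and Fubini, `sahiE_three_prod_eq`), and the identity says

  `E_3^{m₁⊗m₂} = Σ_x m₁(x)·E_3^{m₂}(sections at x) + E_3^{m₁}(a,b,c) + Σ_cyc ( E_{m₁}[a·(bc − b c)] − E_{m₁}[a]·E_{m₁}[bc − b c] )`,

i.e. "average of the conditional `E_3`" + "`E_3` of the conditional means" + a DEFECT: the covariance (under `m₁`) of a section mean
with a conditional covariance.  For `n = 2` the analogue is the law of total covariance and has no defect, which is why positive
association tensorises; the defect term is exactly what the explicit witness of `…SahiTensorLiftFails`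
(`SahiLayer.exists_sahiPositive_three_not_tensor`) makes negative enough: `E_3`-positivity does NOT tensorise.  With `α = Bool` (a coin)
this is the identity behind the two-layer / band reformulation of the first open layer (PROOF-C3 §17(d)).  Elementary; [this work].
-/

namespace Summit.CriticalPhenomena.PercolationContinuityZ3.Theorems.SahiLayer

open Finset Function Literature.Combinatorics.Sahi2008
open scoped BigOperators

variable {α β : Type*} [Fintype α] [Fintype β]

/-- **Law of total `E_3`, moment form**: for a weight `m₁` and seven section statistics `a b c ab ac bc t : α → ℝ` (means, pair
moments, triple moment), the `E_3`-expression of the mixture equals the mixture of the pointwise `E_3`-expressions plus `E_3^{m₁}` of the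
means plus the cyclic sum of `E_{m₁}[a·(bc − b c)] − E_{m₁}[a]·E_{m₁}[bc − b c]`.  Hypothesis-free polynomial identity. [this work] -/
theorem total_E3_abstract (m₁ a b c ab ac bc t : α → ℝ) :
    2 * (∑ x, m₁ x * t x) - (∑ x, m₁ x * a x) * (∑ x, m₁ x * bc x) - (∑ x, m₁ x * b x) * (∑ x, m₁ x * ac x)
        - (∑ x, m₁ x * c x) * (∑ x, m₁ x * ab x) + (∑ x, m₁ x * a x) * (∑ x, m₁ x * b x) * (∑ x, m₁ x * c x) =
      (∑ x, m₁ x * (2 * t x - a x * bc x - b x * ac x - c x * ab x + a x * b x * c x)) +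
        (2 * (∑ x, m₁ x * (a x * b x * c x)) - (∑ x, m₁ x * a x) * (∑ x, m₁ x * (b x * c x))
          - (∑ x, m₁ x * b x) * (∑ x, m₁ x * (a x * c x)) - (∑ x, m₁ x * c x) * (∑ x, m₁ x * (a x * b x))
          + (∑ x, m₁ x * a x) * (∑ x, m₁ x * b x) * (∑ x, m₁ x * c x)) +
        (((∑ x, m₁ x * (a x * (bc x - b x * c x))) - (∑ x, m₁ x * a x) * (∑ x, m₁ x * (bc x - b x * c x))) +
          ((∑ x, m₁ x * (b x * (ac x - a x * c x))) - (∑ x, m₁ x * b x) * (∑ x, m₁ x * (ac x - a x * c x))) +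
          ((∑ x, m₁ x * (c x * (ab x - a x * b x))) - (∑ x, m₁ x * c x) * (∑ x, m₁ x * (ab x - a x * b x)))) := by
  simp only [mul_sub, mul_add, Finset.sum_add_distrib, Finset.sum_sub_distrib, Finset.mul_sum]
  ring_nf
  have h1 : ∑ x, m₁ x * b x * a x * c x = ∑ x, m₁ x * a x * b x * c x := Finset.sum_congr rfl (fun x _ => by ring)
  have h2 : ∑ x, m₁ x * c x * a x * b x = ∑ x, m₁ x * a x * b x * c x := Finset.sum_congr rfl (fun x _ => by ring)
  have h3 : ∑ x, m₁ x * a x * b x * c x * 2 = (∑ x, m₁ x * a x * b x * c x) * 2 := by rw [Finset.sum_mul]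
  rw [h1, h2, h3]
  ring

/-- **Fubini for `E_3` of a product weight**: `E_3^{m₁⊗m₂}(F)` is the left-hand side of `total_E3_abstract` with the section statistics
of `F` under `m₂`. [this work] -/
theorem sahiE_three_prod_eq (m₁ : α → ℝ) (m₂ : β → ℝ) (F : Fin 3 → α × β → ℝ) :
    sahiE (fun p : α × β => m₁ p.1 * m₂ p.2) 3 F =
      2 * (∑ x, m₁ x * ex m₂ (fun y => F 0 (x, y) * F 1 (x, y) * F 2 (x, y)))
        - (∑ x, m₁ x * ex m₂ (fun y => F 0 (x, y))) * (∑ x, m₁ x * ex m₂ (fun y => F 1 (x, y) * F 2 (x, y)))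
        - (∑ x, m₁ x * ex m₂ (fun y => F 1 (x, y))) * (∑ x, m₁ x * ex m₂ (fun y => F 0 (x, y) * F 2 (x, y)))
        - (∑ x, m₁ x * ex m₂ (fun y => F 2 (x, y))) * (∑ x, m₁ x * ex m₂ (fun y => F 0 (x, y) * F 1 (x, y)))
        + (∑ x, m₁ x * ex m₂ (fun y => F 0 (x, y))) * (∑ x, m₁ x * ex m₂ (fun y => F 1 (x, y))) *
            (∑ x, m₁ x * ex m₂ (fun y => F 2 (x, y))) := by
  rw [sahiE_three_apply]
  simp only [ex, Fintype.sum_prod_type, Pi.mul_apply, mul_assoc, ← Finset.mul_sum]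
  ring

/-- **Law of total `E_3` for a product weight** (`total_E3_abstract` with the section statistics of `F`): conditional `E_3` average
+ `E_3` of the section means + the defect. [this work] -/
theorem sahiE_three_prod (m₁ : α → ℝ) (m₂ : β → ℝ) (F : Fin 3 → α × β → ℝ) :
    sahiE (fun p : α × β => m₁ p.1 * m₂ p.2) 3 F =
      (∑ x, m₁ x * (2 * ex m₂ (fun y => F 0 (x, y) * F 1 (x, y) * F 2 (x, y))
          - ex m₂ (fun y => F 0 (x, y)) * ex m₂ (fun y => F 1 (x, y) * F 2 (x, y))
          - ex m₂ (fun y => F 1 (x, y)) * ex m₂ (fun y => F 0 (x, y) * F 2 (x, y))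
          - ex m₂ (fun y => F 2 (x, y)) * ex m₂ (fun y => F 0 (x, y) * F 1 (x, y))
          + ex m₂ (fun y => F 0 (x, y)) * ex m₂ (fun y => F 1 (x, y)) * ex m₂ (fun y => F 2 (x, y)))) +
      (2 * (∑ x, m₁ x * (ex m₂ (fun y => F 0 (x, y)) * ex m₂ (fun y => F 1 (x, y)) * ex m₂ (fun y => F 2 (x, y))))
          - (∑ x, m₁ x * ex m₂ (fun y => F 0 (x, y))) * (∑ x, m₁ x * (ex m₂ (fun y => F 1 (x, y)) * ex m₂ (fun y => F 2 (x, y))))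
          - (∑ x, m₁ x * ex m₂ (fun y => F 1 (x, y))) * (∑ x, m₁ x * (ex m₂ (fun y => F 0 (x, y)) * ex m₂ (fun y => F 2 (x, y))))
          - (∑ x, m₁ x * ex m₂ (fun y => F 2 (x, y))) * (∑ x, m₁ x * (ex m₂ (fun y => F 0 (x, y)) * ex m₂ (fun y => F 1 (x, y))))
          + (∑ x, m₁ x * ex m₂ (fun y => F 0 (x, y))) * (∑ x, m₁ x * ex m₂ (fun y => F 1 (x, y))) *
              (∑ x, m₁ x * ex m₂ (fun y => F 2 (x, y)))) +
      (((∑ x, m₁ x * (ex m₂ (fun y => F 0 (x, y)) *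
            (ex m₂ (fun y => F 1 (x, y) * F 2 (x, y)) - ex m₂ (fun y => F 1 (x, y)) * ex m₂ (fun y => F 2 (x, y)))))
          - (∑ x, m₁ x * ex m₂ (fun y => F 0 (x, y))) *
            (∑ x, m₁ x * (ex m₂ (fun y => F 1 (x, y) * F 2 (x, y)) - ex m₂ (fun y => F 1 (x, y)) * ex m₂ (fun y => F 2 (x, y))))) +
        ((∑ x, m₁ x * (ex m₂ (fun y => F 1 (x, y)) *
            (ex m₂ (fun y => F 0 (x, y) * F 2 (x, y)) - ex m₂ (fun y => F 0 (x, y)) * ex m₂ (fun y => F 2 (x, y)))))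
          - (∑ x, m₁ x * ex m₂ (fun y => F 1 (x, y))) *
            (∑ x, m₁ x * (ex m₂ (fun y => F 0 (x, y) * F 2 (x, y)) - ex m₂ (fun y => F 0 (x, y)) * ex m₂ (fun y => F 2 (x, y))))) +
        ((∑ x, m₁ x * (ex m₂ (fun y => F 2 (x, y)) *
            (ex m₂ (fun y => F 0 (x, y) * F 1 (x, y)) - ex m₂ (fun y => F 0 (x, y)) * ex m₂ (fun y => F 1 (x, y)))))
          - (∑ x, m₁ x * ex m₂ (fun y => F 2 (x, y))) *
            (∑ x, m₁ x * (ex m₂ (fun y => F 0 (x, y) * F 1 (x, y)) - ex m₂ (fun y => F 0 (x, y)) * ex m₂ (fun y => F 1 (x, y)))))) := by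
  rw [sahiE_three_prod_eq]
  exact total_E3_abstract m₁ (fun x => ex m₂ (fun y => F 0 (x, y))) (fun x => ex m₂ (fun y => F 1 (x, y)))
    (fun x => ex m₂ (fun y => F 2 (x, y))) (fun x => ex m₂ (fun y => F 0 (x, y) * F 1 (x, y)))
    (fun x => ex m₂ (fun y => F 0 (x, y) * F 2 (x, y))) (fun x => ex m₂ (fun y => F 1 (x, y) * F 2 (x, y)))
    (fun x => ex m₂ (fun y => F 0 (x, y) * F 1 (x, y) * F 2 (x, y)))

end Summit.CriticalPhenomena.PercolationContinuityZ3.Theorems.SahiLayer
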